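import Summits.SmoothPoincare4.SmoothPoincare4.Theorems.CongruenceShadowsGriffithsHandlebodyExtensionCoverPlanarH
import Literature.Topology.FourManifolds.TorusMappingClassFaithfulModel
import HarnessLib

/-!
# SmoothPoincare4 / CongruenceShadows — `GriffithsHandlebodyExtension` (item stmt-SmoothPoincare4-15190): genus one, unconditionally

Support file (`--supports` stmt-SmoothPoincare4-15190).  The homothety-cover development
(`…CoverDefs` … `…CoverPlanarH`) proves (E) = `HomothetyCover.forall_diffeoExtends`: every
self-diffeomorphism of the Heegaard torus `∂V` of the round solid torus fixing the base point and acting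
trivially on `π₁(∂V)` extends to a self-diffeomorphism of `V`.  Fed into the tree's reduction
`Literature.Topology.FourManifolds.RoundSolidTorusModel.griffithsExtension_genus_one_of_forall_diffeoExtends`
this gives the genus-one clause of `Literature.Topology.FourManifolds.GriffithsExtension` (= the route
statement `GriffithsHandlebodyExtension` at `g = 1`) with NO mapping-class-group input
(`TorusMappingClassFaithful` is not used), and reduces the whole item to Griffiths' criterion on the
flower handlebodies of genus `≥ 2` (`griffithsExtension_of_forall_diffeoExtends_of_flower`).
-/

-- the registered namespace `Summit.SmoothPoincare4.SmoothPoincare4.Theorems` repeats a component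
set_option linter.dupNamespace false

noncomputable section

namespace Summit.SmoothPoincare4.SmoothPoincare4.Theorems

namespace HomothetyCover

open Literature.Topology.FourManifolds Literature.Topology.FourManifolds.RoundSolidTorusModel
open scoped Manifold ContDiff

/-- **Griffiths' extension criterion in genus one, unconditionally**: every kernel-preserving
self-diffeomorphism of any boundary datum of any genus-`1` handlebody extends over it (the tree's
reduction `griffithsExtension_genus_one_of_forall_diffeoExtends` fed with (E) =
`HomothetyCover.forall_diffeoExtends`). -/
theorem griffiths_genus_one
    (H : Type) [TopologicalSpace H] [T2Space H] [SecondCountableTopology H]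
    [ChartedSpace (EuclideanHalfSpace 3) H] [IsManifold (𝓡∂ 3) ∞ H]
    (hH : IsHandlebody 1 H) (b : BoundaryData (𝓡∂ 3) H (𝓡 2))
    (ψ : b.carrier ≃ₘ⟮𝓡 2, 𝓡 2⟯ b.carrier) (x₀ : b.carrier)
    (hker : ((FundamentalGroup.map (⟨b.incl, b.continuous_incl⟩ : C(b.carrier, H)) x₀).ker).map
        (FundamentalGroup.map (⟨ψ, ψ.continuous⟩ : C(b.carrier, b.carrier)) x₀)
      = (FundamentalGroup.map (⟨b.incl, b.continuous_incl⟩ : C(b.carrier, H))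
          ((⟨ψ, ψ.continuous⟩ : C(b.carrier, b.carrier)) x₀)).ker) :
    b.DiffeoExtends ψ :=
  griffithsExtension_genus_one_of_forall_diffeoExtends
    (fun τ hτ h => forall_diffeoExtends τ hτ h) H hH b ψ x₀ hker

/-- **The item reduced to the flower criterion**: `GriffithsExtension` (all genera) follows from
Griffiths' criterion `h₂` on the flower handlebodies of genus `≥ 2` alone, the genus-one input of
`griffithsExtension_of_forall_diffeoExtends_of_flower` being discharged by (E). -/
theorem griffithsExtension_of_flower
    (h₂ : ∀ (g : ℕ) (hg : 2 ≤ g)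
      (χ : (BoundaryManifold.boundaryData 2 (FlowerModel.FlowerHandlebody hg)).carrier ≃ₘ⟮𝓡 2, 𝓡 2⟯
        (BoundaryManifold.boundaryData 2 (FlowerModel.FlowerHandlebody hg)).carrier)
      (y₀ : (BoundaryManifold.boundaryData 2 (FlowerModel.FlowerHandlebody hg)).carrier),
      ((FundamentalGroup.map (⟨(BoundaryManifold.boundaryData 2 (FlowerModel.FlowerHandlebody hg)).incl,
          (BoundaryManifold.boundaryData 2 (FlowerModel.FlowerHandlebody hg)).continuous_incl⟩ :
            C((BoundaryManifold.boundaryData 2 (FlowerModel.FlowerHandlebody hg)).carrier,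
              FlowerModel.FlowerHandlebody hg)) y₀).ker).map
          (FundamentalGroup.map (⟨χ, χ.continuous⟩ : C(_, _)) y₀)
        = (FundamentalGroup.map (⟨(BoundaryManifold.boundaryData 2 (FlowerModel.FlowerHandlebody hg)).incl,
            (BoundaryManifold.boundaryData 2 (FlowerModel.FlowerHandlebody hg)).continuous_incl⟩ :
              C((BoundaryManifold.boundaryData 2 (FlowerModel.FlowerHandlebody hg)).carrier,
                FlowerModel.FlowerHandlebody hg))
            ((⟨χ, χ.continuous⟩ : C(_, _)) y₀)).ker →
        (BoundaryManifold.boundaryData 2 (FlowerModel.FlowerHandlebody hg)).DiffeoExtends χ) :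
    GriffithsExtension :=
  griffithsExtension_of_forall_diffeoExtends_of_flower (fun τ hτ h => forall_diffeoExtends τ hτ h) h₂

end HomothetyCover

end Summit.SmoothPoincare4.SmoothPoincare4.Theorems

end
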